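import Summits.PneNP.PneNP.Theorems.BruckRyserSosSosBlindPlanesTemplateSum
import Summits.PneNP.PneNP.Theorems.BruckRyserSosSosBlindPlanesTraces

/-!
# PneNP / BruckRyserSos — positive semidefiniteness of invariant moment matrices from traces

Route `PneNP/BruckRyserSos`, crux stmt-PneNP-16761 (`SosBlindPlanes`).

The moment matrix `M` of an invariant table on the `v × v` board has size growing with `v`, but it
commutes with the board symmetry group, whose invariant matrices are determined by their entries
at finitely many template pairs. Hence (`exists_annihilating_poly`) `M` satisfies a nonzero
polynomial of degree `≤ K₁` (`K₁` = number of template pairs, INDEPENDENT of `v`), so it has at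
most `K₁` distinct eigenvalues, and by Lagrange interpolation on the spectrum
(`…Traces.posSemidef_of_trace_nonneg`):

  `M ⪰ 0 ⟺ tr (M q(M)²) ≥ 0` for every real polynomial `q` of degree `< K₁`
  (`momMatrix_posSemidef_of_trace_nonneg`).

Together with the closed-walk formula (`…Traces.trace_pow_succ`) and the template-sum formula of
file `…TemplateSum`, the right-hand side is a finite conjunction of polynomial inequalities in
the order and the table — uniformly in `v`.

References: R. A. Horn, C. R. Johnson, *Matrix Analysis* (2nd ed.), §1.1 (annihilating
polynomials); folklore.
-/

set_option linter.dupNamespace false -- `Summit.PneNP.PneNP.…`: summit = sub-problem name (D-0017 single-conjunct layout)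

noncomputable section

namespace Summit.PneNP.PneNP.Theorems.SosBlindPlanes

open Finset Function Matrix Polynomial

/-! ### Invariant matrices on the board satisfy a polynomial of bounded degree -/

section Invariant

variable {v D h : ℕ}

/-- Invariance of a matrix on board configurations under the board symmetry group. [folklore] -/
def MInv (A : Matrix (Idx v h) (Idx v h) ℝ) : Prop :=
  ∀ (σ τ : Equiv.Perm (Fin v)) (S T : Idx v h), A (act σ τ S) (act σ τ T) = A S T

/-- Products of invariant matrices are invariant. [folklore] -/
theorem MInv.mul {A B : Matrix (Idx v h) (Idx v h) ℝ} (hA : MInv A) (hB : MInv B) :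
    MInv (A * B) := by
  intro σ τ S T
  simp only [Matrix.mul_apply]
  rw [← (actEquiv (h := h) σ τ).sum_comp]
  simp only [actEquiv_apply, hA σ τ, hB σ τ]

/-- The action by a pair of permutations is injective. [folklore] -/
theorem act_injective (σ τ : Equiv.Perm (Fin v)) : Function.Injective (act (h := h) σ τ) :=
  (actEquiv σ τ).injective

/-- The identity matrix is invariant. [folklore] -/
theorem MInv.one : MInv (1 : Matrix (Idx v h) (Idx v h) ℝ) := by
  intro σ τ S T
  simp only [Matrix.one_apply, (act_injective σ τ).eq_iff]

/-- Powers of an invariant matrix are invariant. [folklore] -/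
theorem MInv.pow {A : Matrix (Idx v h) (Idx v h) ℝ} (hA : MInv A) (k : ℕ) : MInv (A ^ k) := by
  induction k with
  | zero => rw [pow_zero]; exact MInv.one
  | succ k ih => rw [pow_succ]; exact ih.mul hA

/-- Scalar multiples of an invariant matrix are invariant. [folklore] -/
theorem MInv.smul {A : Matrix (Idx v h) (Idx v h) ℝ} (hA : MInv A) (r : ℝ) : MInv (r • A) := by
  intro σ τ S T
  simp only [Matrix.smul_apply, hA σ τ S T]

/-- Sums of invariant matrices are invariant. [folklore] -/
theorem MInv.sum {α : Type*} (s : Finset α) {A : α → Matrix (Idx v h) (Idx v h) ℝ}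
    (hA : ∀ a ∈ s, MInv (A a)) : MInv (∑ a ∈ s, A a) := by
  intro σ τ S T
  simp only [Matrix.sum_apply]
  exact sum_congr rfl fun a ha => hA a ha σ τ S T

/-- An invariant matrix vanishing at all template pairs vanishes (`2h ≤ D ≤ v`). [folklore] -/
theorem MInv.eq_zero_of_forall_template (hD : 0 < D) (hDv : D ≤ v) (h2 : 2 * h ≤ D)
    {A : Matrix (Idx v h) (Idx v h) ℝ} (hA : MInv A)
    (hres : ∀ S₀ T₀ : Idx D h, A (embIdx hDv S₀) (embIdx hDv T₀) = 0) : A = 0 := by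
  ext S T
  -- move `S ∪ T` into the grid
  have hP : (pts (S.1 ∪ T.1)).card ≤ (gridSet hDv).card := by
    rw [card_gridSet]
    refine (card_pts_le _).trans ((card_union_le _ _).trans ?_)
    have := S.2; have := T.2; omega
  have hL : (lns (S.1 ∪ T.1)).card ≤ (gridSet hDv).card := by
    rw [card_gridSet]
    refine (card_lns_le _).trans ((card_union_le _ _).trans ?_)
    have := S.2; have := T.2; omega
  obtain ⟨σ, τ, hσP, hσL⟩ := exists_perm_rel_subset (S.1 ∪ T.1) _ _ hP hL
  have hS := (exists_emb_eq_iff (j := 1) hD hDv (fun _ => act σ τ S)).2 ⟨?_, ?_⟩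
  · have hT := (exists_emb_eq_iff (j := 1) hD hDv (fun _ => act σ τ T)).2 ⟨?_, ?_⟩
    · obtain ⟨ωS, hωS⟩ := hS
      obtain ⟨ωT, hωT⟩ := hT
      have h1 : embIdx hDv (ωS 0) = act σ τ S := congrFun hωS 0
      have h2 : embIdx hDv (ωT 0) = act σ τ T := congrFun hωT 0
      rw [Matrix.zero_apply, ← hA σ τ S T, ← h1, ← h2]
      exact hres _ _
    · intro p hp
      simp only [suppP, mem_biUnion, mem_univ, true_and, exists_const, act_val] at hp
      exact hσP (pts_mono (rel_mono σ τ subset_union_right) hp)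
    · intro q hq
      simp only [suppL, mem_biUnion, mem_univ, true_and, exists_const, act_val] at hq
      exact hσL (lns_mono (rel_mono σ τ subset_union_right) hq)
  · intro p hp
    simp only [suppP, mem_biUnion, mem_univ, true_and, exists_const, act_val] at hp
    exact hσP (pts_mono (rel_mono σ τ subset_union_left) hp)
  · intro q hq
    simp only [suppL, mem_biUnion, mem_univ, true_and, exists_const, act_val] at hq
    exact hσL (lns_mono (rel_mono σ τ subset_union_left) hq)

/-- **An invariant matrix satisfies a nonzero polynomial of degree at most the number of
template pairs** (`2h ≤ D ≤ v`). [Horn–Johnson §1.1] [folklore] -/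
theorem exists_annihilating_poly (hD : 0 < D) (hDv : D ≤ v) (h2 : 2 * h ≤ D)
    {A : Matrix (Idx v h) (Idx v h) ℝ} (hA : MInv A) :
    ∃ g : ℝ[X], g ≠ 0 ∧ g.natDegree ≤ Fintype.card (Idx D h × Idx D h) ∧ aeval A g = 0 := by
  classical
  set K₁ := Fintype.card (Idx D h × Idx D h) with hK₁
  -- the restrictions of `A^0, …, A^{K₁}` to template pairs are linearly dependent
  let u : Fin (K₁ + 1) → (Idx D h × Idx D h → ℝ) := fun i p =>
    (A ^ (i : ℕ)) (embIdx hDv p.1) (embIdx hDv p.2)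
  have hdep : ¬ LinearIndependent ℝ u := by
    intro hli
    have := hli.fintype_card_le_finrank
    rw [Module.finrank_fintype_fun_eq_card, Fintype.card_fin] at this
    omega
  obtain ⟨c, hc0, i₀, hi₀⟩ := Fintype.not_linearIndependent_iff.1 hdep
  refine ⟨∑ i : Fin (K₁ + 1), monomial (i : ℕ) (c i), ?_, ?_, ?_⟩
  · intro hzero
    have := congrArg (fun p : ℝ[X] => p.coeff (i₀ : ℕ)) hzero
    simp only [finsetSum_coeff, coeff_monomial, coeff_zero, Fin.val_inj] at this
    rw [Finset.sum_ite_eq' univ i₀] at this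
    simp only [mem_univ, if_true] at this
    exact hi₀ this
  · refine natDegree_sum_le_of_forall_le _ _ fun i _ => ?_
    exact (natDegree_monomial_le _).trans (by have := i.2; omega)
  · rw [map_sum]
    have hB : MInv (∑ i : Fin (K₁ + 1), aeval A (monomial (i : ℕ) (c i))) := by
      refine MInv.sum _ fun i _ => ?_
      rw [aeval_monomial, Algebra.algebraMap_eq_smul_one, smul_mul_assoc, one_mul]
      exact (hA.pow _).smul _
    refine hB.eq_zero_of_forall_template hD hDv h2 fun S₀ T₀ => ?_
    have := congrFun hc0 (S₀, T₀)
    simp only [Finset.sum_apply, Pi.smul_apply, smul_eq_mul, Pi.zero_apply, u] at this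
    rw [Matrix.sum_apply]
    rw [← this]
    refine sum_congr rfl fun i _ => ?_
    rw [aeval_monomial, Algebra.algebraMap_eq_smul_one, smul_mul_assoc, one_mul, Matrix.smul_apply,
      smul_eq_mul]

/-- The moment matrix of an invariant table is invariant. [folklore] -/
theorem mInv_momMatrix {μ : Finset (Fin D × Fin D) → ℝ} (hμ : TabInv μ) (hD : 0 < D) :
    MInv (momMatrix v D h μ) :=
  fun σ τ S T => momMatrix_act hμ hD σ τ S T

/-- **PSD criterion for the moment matrix, uniformly in the board size.** If the table is
invariant, `2h ≤ D ≤ v`, and `tr (M q(M) q(M)) ≥ 0` for every real polynomial `q` of degree less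
than the number `K₁` of template pairs, then the moment matrix `M` is positive semidefinite.
[folklore] -/
theorem momMatrix_posSemidef_of_trace_nonneg {μ : Finset (Fin D × Fin D) → ℝ} (hμ : TabInv μ)
    (hD : 0 < D) (hDv : D ≤ v) (h2 : 2 * h ≤ D)
    (hpos : ∀ q : ℝ[X], q.natDegree < Fintype.card (Idx D h × Idx D h) →
      0 ≤ (momMatrix v D h μ * aeval (momMatrix v D h μ) q * aeval (momMatrix v D h μ) q).trace) :
    (momMatrix v D h μ).PosSemidef :=
  posSemidef_of_trace_nonneg (momMatrix_isHermitian μ)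
    (exists_annihilating_poly hD hDv h2 (mInv_momMatrix hμ hD)) hpos

end Invariant

end Summit.PneNP.PneNP.Theorems.SosBlindPlanes
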